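import Mathlib
import HarnessLib
import Literature.MathematicalPhysics.StatisticalMechanics.RenormalisationMapFreeHtKernelRaw
import Literature.MathematicalPhysics.StatisticalMechanics.RenormalisationMapBlockDefectBlockFree
import Literature.MathematicalPhysics.StatisticalMechanics.RenormalisationMapTwoKernelWeak

/-!
# `‖nextK(μ_a; e^{−H}, e^{−H̃}, K) − nextK(μ_b; e^{−H}, e^{−H̃}, K)‖_{k+1}^{(A)} ≤ Θ₂` — two step kernels at a COMMON FREE `H̃`,
# weak norm, kernel level ([ABKM19] Theorem 6.8 ⊗ Lemma 8.4 ⊗ Lemma 9.3; block U2 of (12.53) at `ℓ = 2`)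

The weak-norm conversion of the six-piece bound (`RenormalisationMapFreeHtKernelRaw`): block part `Θ₀·A^{−|U|_{k+1}}`, the `Σ₁`
kernel-only twin and the defect twin in block form (`L^dκ₁^{L^d}[…]·A·A^{−|U|_{k+1}}`), and the three large kernel-only twins with
`κ^{|U|_k}·c^{|U|_{k+1}}·A^{−η|U|_{k+1}}` absorbed WITH ROOM `λ` (counting conditions `hc3b/hc2b` at the per-block constant
`max(A_𝒫, κ_p)`) so that the `U`-dependence of the near-`U` pair constant `ℓ_n(U)` is absorbed (`ℓ_n(U)·λ^{|U|_{k+1}} ≤ ℓ̄`) — verbatim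
the kernel-only half of `RenormalisationMapTwoKernelWeak`.  The defect twin carries `16e^{3/8}‖H̃_a − H̃_b‖_{k,0}` (`O(|q_a − q_b|₁)` by
`NextHamiltonianKernelSubABKM`); every other term carries `ℓc`, `ℓ̄` or `δγ`.  `Θ₂` does not depend on `U` nor on `H̃` (beyond
`‖H̃‖_{k,0} ≤ τ`): this is the uniform kernel-pair bound (U2) consumed by the Cauchy estimate of the blocks B2/B3 of the stub
`stub_f4l2ShrinkLoc`.

* **`weakNormLE_nextK_freeHt_kernel_sub_abkm_of_stepKernelBounds`**.

Everything is proved; no named fact.  Honest scope: rung route `Summits/HubbardSuperconductivity/…/Theses/ComplexGFFStiffness`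
(stiffness of a complex Gaussian gradient field via the [ABKM19] RG); nothing about superconductivity in the Hubbard model is claimed.

## References
* S. Adams, S. Buchholz, R. Kotecký, S. Müller, arXiv:1910.13564, Theorem 6.8 ((6.59)–(6.60)), Lemma 8.4, Lemma 9.3, Ch. 12 (12.4),
  Lemma 12.6 (12.53) [AdamsBuchholzKoteckyMuller2019].
-/

noncomputable section

namespace Literature.MathematicalPhysics.StatisticalMechanics.GradientRG

open scoped BigOperators Classical
open Finset MeasureTheory
open Literature.MathematicalPhysics.StatisticalMechanics.TorusPolymer
  (IsPolymer blocks polys bprod blockOf thicken reblock boxCorner mem_polys mem_blocks numBlocks isPolymer_blockOf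
    card_blocks_eq_numBlocks blocks_blockOf empty_mem_polys closure mem_blockOf_self)
open Literature.Barriers.CriticalPhenomena.LongRangePhi4.Polymer (IsConn components)
open Literature.MathematicalPhysics.StatisticalMechanics.GradientFRD (iterDiff)
open Literature.MathematicalPhysics.QuantumFieldTheory

variable {d M : ℕ} [NeZero M]

set_option maxHeartbeats 1600000 in
/-- **`‖nextK(μ_a; e^{−H}, e^{−H̃}, K) − nextK(μ_b; e^{−H}, e^{−H̃}, K)‖_{k+1}^{(A)} ≤ Θ₂`** (module docstring): hypotheses of
`tayNormLE_nextK_freeHt_kernel_sub_abkm_raw_of_stepKernelBounds` with the near-`U` pair constant `ℓ_n(U)` absorbed by the room `λ`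
(`ℓ_n(U)·λ^{|U|_{k+1}} ≤ ℓ̄`) and the counting conditions `hc3b/hc2b` of [ABKM19] Ch. 12 (12.4) with room.
[cite: AdamsBuchholzKoteckyMuller2019, Theorem 6.8 (6.59)–(6.60) / Lemma 8.4 / Lemma 12.6 (12.53)] -/
theorem weakNormLE_nextK_freeHt_kernel_sub_abkm_of_stepKernelBounds {L N Mord R n p r₀ : ℕ}
    {θbar lam μ δ₁ δ₀ A𝒫 A𝒫a A𝒫b C₂a C₂b h A : ℝ}
    {𝒞 : ℕ → (Fin d → ZMod M) → ℝ} (hd : 3 ≤ d) (hLodd : Odd L) (hL : 2 ^ (d + 3) + 16 * R ≤ L)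
    (hR2 : 2 ≤ R) (hM : M = L ^ N) {k : ℕ} (hkN : k + 1 ≤ N)
    (hp : d / 2 + 2 ≤ p) (hpM : p + d ≤ Mord) (hMR : Mord ≤ R) (hr₀ : 3 ≤ r₀)
    (hB : AbkmWeightBounds L N Mord R n θbar lam μ δ₁ δ₀ A𝒫 𝒞
      (abkmWeightData L N Mord R θbar (schedDelta δ₀ δ₁ N) 𝒞))
    (hδ₀ : 0 < δ₀) (hδ₁ : 0 < δ₁) (hh : 0 < h) (hh0 : hZeroSq d R δ₀ δ₁ ≤ h ^ 2)
    (hh2a : C₂a ≤ h ^ 2) (hh2b : C₂b ≤ h ^ 2) (hA𝒫a : 0 ≤ A𝒫a) (hA𝒫b : 0 ≤ A𝒫b) (hA1 : 1 ≤ A)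
    {κc : ℝ} (hκc : 0 ≤ κc) (hκcA : κc ≤ A)
    (hsmallc : (2 : ℝ) ^ (L ^ d) * (κc * A ^ (-(1 - (1 + 1 / ((2 * (2 ^ d + 1) + 6 : ℝ) ^ d))⁻¹) : ℝ)) ≤ 1)
    (D Db : StepData d M) (hDs : D.s = L ^ k) (hDL : D.L = L) (hDbs : Db.s = L ^ k) (hDbL : Db.L = L)
    (hS : StepKernelBounds (abkmWeightData L N Mord R θbar (schedDelta δ₀ δ₁ N) 𝒞) L k A𝒫a C₂a D.𝒞)
    (hSb : StepKernelBounds (abkmWeightData L N Mord R θbar (schedDelta δ₀ δ₁ N) 𝒞) L k A𝒫b C₂b Db.𝒞)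
    {x₀ : Fin d → ZMod M} (hB₀ : D.B₀ = blockOf (L ^ k) x₀) (hc₀ : D.c₀ = boxCorner (L ^ k) (starRad R L d k) x₀)
    (hDbB : Db.B₀ = D.B₀) (hDbc : Db.c₀ = D.c₀)
    {δγ : ℝ} (hδγ : 0 ≤ δγ)
    (hγab : ∀ q, ((L ^ (d * k) : ℕ) : ℝ) * |gradCov D.𝒞 q - gradCov Db.𝒞 q| ≤ δγ)
    {ℓc : ℝ} (hℓc : 0 ≤ ℓc)
    (hdint : ∀ X : Finset (Fin d → ZMod M), IsPolymer (L ^ k) X → IsConn X →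
      ∀ (F : ((Fin d → ZMod M) → ℝ) → ℂ) (C : ℝ), 0 ≤ C → ContDiff ℝ r₀ F →
        IsGaugeLocal ((abkmNormParams L N Mord R p r₀ h θbar A (schedDelta δ₀ δ₁ N) 𝒞).gauge k X) F →
        TayNormLE ((abkmNormParams L N Mord R p r₀ h θbar A (schedDelta δ₀ δ₁ N) 𝒞).gauge k X) r₀
          ((abkmWeightData L N Mord R θbar (schedDelta δ₀ δ₁ N) 𝒞).weight k X) F C →
          TayNormLE ((abkmNormParams L N Mord R p r₀ h θbar A (schedDelta δ₀ δ₁ N) 𝒞).gauge k X) r₀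
            ((abkmWeightData L N Mord R θbar (schedDelta δ₀ δ₁ N) 𝒞).midWeight k X)
            (fluct D.𝒞 F - fluct Db.𝒞 F) (C * ℓc * κc ^ numBlocks (L ^ k) X))
    {κp : ℝ} (hκp : 0 ≤ κp) {ℓnf : Finset (Fin d → ZMod M) → ℝ} {ℓbar lamR : ℝ}
    (hℓn0 : ∀ U : Finset (Fin d → ZMod M), 0 ≤ ℓnf U)
    (hℓn : ∀ U : Finset (Fin d → ZMod M), ℓnf U * lamR ^ (blocks (L * L ^ k) U).card ≤ ℓbar)
    (hlam0 : 0 ≤ lamR) (hlam1 : lamR ≤ 1)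
    (hdiffU : ∀ U : Finset (Fin d → ZMod M), IsPolymer (L ^ (k + 1)) U → IsConn U →
      ∀ X : Finset (Fin d → ZMod M), IsPolymer (L ^ k) X → X ⊆ thicken ((2 ^ d - 1) * L ^ k) U →
      ∀ (F : ((Fin d → ZMod M) → ℝ) → ℂ) (b : ℝ), 0 ≤ b → ContDiff ℝ r₀ F →
        IsGaugeLocal ((abkmNormParams L N Mord R p r₀ h θbar A (schedDelta δ₀ δ₁ N) 𝒞).gauge k X) F →
        TayNormLE ((abkmNormParams L N Mord R p r₀ h θbar A (schedDelta δ₀ δ₁ N) 𝒞).gauge k X) r₀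
          ((abkmWeightData L N Mord R θbar (schedDelta δ₀ δ₁ N) 𝒞).weight k X) F b →
          TayNormLE ((abkmNormParams L N Mord R p r₀ h θbar A (schedDelta δ₀ δ₁ N) 𝒞).gauge k X) r₀
            ((abkmWeightData L N Mord R θbar (schedDelta δ₀ δ₁ N) 𝒞).midWeight k X)
            (fluct D.𝒞 F - fluct Db.𝒞 F) (b * ℓnf U * κp ^ numBlocks (L ^ k) X))
    {H : RelevantHamiltonian ℂ d} {b : ℝ}
    (hH : hamNorm (fieldWt h (L : ℝ) d k) ((L : ℝ) ^ k) (L ^ (d * k)) H ≤ b) (hb : b ≤ 1 / 64)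
    {K : Finset (Fin d → ZMod M) → ((Fin d → ZMod M) → ℝ) → ℂ} {C : ℝ} (hC : 0 ≤ C)
    (hK : WeakNormLE (abkmNormParams L N Mord R p r₀ h θbar A (schedDelta δ₀ δ₁ N) 𝒞) k K C)
    (hKfac : Factorises (L ^ k) K) (hK0 : ∀ φ, K ∅ φ = 1) (hKd : ∀ Y, ContDiff ℝ r₀ (K Y))
    (hKloc : ∀ Y, IsPolymer (L ^ k) Y → IsConn Y →
      IsGaugeLocal ((abkmNormParams L N Mord R p r₀ h θbar A (schedDelta δ₀ δ₁ N) 𝒞).gauge k Y) (K Y))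
    (hKt : TransInv (L ^ k) K)
    (hva : pi2BoundConst d (((2 * R + 2 : ℕ) : ℝ) + ((d / 2 + 1 : ℕ) : ℝ)) * (C * A𝒫a * A⁻¹) ≤ 1 / 64)
    (hvb : pi2BoundConst d (((2 * R + 2 : ℕ) : ℝ) + ((d / 2 + 1 : ℕ) : ℝ)) * (C * A𝒫b * A⁻¹) ≤ 1 / 64)
    {τ : ℝ} (hτa : 2 * b + pi2BoundConst d (((2 * R + 2 : ℕ) : ℝ) + ((d / 2 + 1 : ℕ) : ℝ)) * (C * A𝒫a * A⁻¹) ≤ τ)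
    (hτb : 2 * b + pi2BoundConst d (((2 * R + 2 : ℕ) : ℝ) + ((d / 2 + 1 : ℕ) : ℝ)) * (C * A𝒫b * A⁻¹) ≤ τ)
    (hτ : τ ≤ 1 / 16)
    {Ht : RelevantHamiltonian ℂ d} (hHt : hamNorm (fieldWt h (L : ℝ) d k) ((L : ℝ) ^ k) (L ^ (d * k)) Ht ≤ τ)
    {ω κ κ₁ : ℝ}
    (hω1 : 8 * Real.exp (1 / 4) * τ ≤ ω)
    (hω2 : 8 * Real.exp (1 / 4) * b + 8 * Real.exp (1 / 4) * b ≤ ω)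
    (hω3 : C + C ≤ ω) (hωA : ω * A ^ 2 ≤ 1)
    (hκ : 1 + Real.exp (1 / 4) ≤ κ)
    (hκ₁' : 1 + Real.exp (1 / 4) + 16 * Real.exp (3 / 8) * τ ≤ κ₁)
    (hc3b : κ ^ (L ^ d) * ((2 * (2 * κ * max 1 (max A𝒫a κp))) ^ ((2 ^ (d + 1) + 2) ^ d * L ^ d) * (4 : ℝ) ^ ((2 ^ (d + 1) + 2) ^ d * L ^ d)) ≤ lamR * A ^ ((1 + 1 / ((2 * (2 ^ d + 1) + 6 : ℝ) ^ d)) - 1 : ℝ))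
    (hc2b : κ ^ (L ^ d) * ((2 * κ * max 1 (max A𝒫a κp)) ^ ((2 ^ (d + 1) + 2) ^ d * L ^ d) * (2 : ℝ) ^ ((2 ^ (d + 1) + 2) ^ d * L ^ d)) ≤ lamR * A ^ ((1 + 1 / ((2 * (2 ^ d + 1) + 6 : ℝ) ^ d)) - 1 : ℝ)) :
    WeakNormLE (abkmNormParams L N Mord R p r₀ h θbar A (schedDelta δ₀ δ₁ N) 𝒞) (k + 1)
      (fun U φ => nextK D.s (reblock D.s (D.L * D.s)) (stepMeasure D.𝒞) (expNegH H) (expNegH Ht) K U φ -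
        nextK Db.s (reblock Db.s (Db.L * Db.s)) (stepMeasure Db.𝒞) (expNegH H) (expNegH Ht) K U φ)
      ((C * ((L : ℝ) ^ d * ((ℓc * κc) * abkmContrConst d L R) +
          ℓc * largePartEps d L A κc (1 + 1 / ((2 * (2 ^ d + 1) + 6 : ℝ) ^ d)) +
          ℓc * largePartEps d L A κc (1 + 1 / ((2 * (2 ^ d + 1) + 6 : ℝ) ^ d)))) +
        ((L ^ d : ℕ) : ℝ) * κ₁ ^ (L ^ d) *
        (16 * Real.exp (3 / 8) * τ *
            ((1 + 8 * pi2BoundConst d (((2 * R + 2 : ℕ) : ℝ) + ((d / 2 + 1 : ℕ) : ℝ))) * (C * ℓc * κc * A⁻¹)) +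
          (512 * Real.exp (1 / 4) *
              (b * (pi2BoundConst d (((2 * R + 2 : ℕ) : ℝ) + ((d / 2 + 1 : ℕ) : ℝ)) * (C * ℓc * κc * A⁻¹))) +
            256 * Real.exp (1 / 4) *
              (pi2BoundConst d (((2 * R + 2 : ℕ) : ℝ) + ((d / 2 + 1 : ℕ) : ℝ)) * (C * A𝒫b * A⁻¹) +
                pi2BoundConst d (((2 * R + 2 : ℕ) : ℝ) + ((d / 2 + 1 : ℕ) : ℝ)) * (C * ℓc * κc * A⁻¹)) *
              (pi2BoundConst d (((2 * R + 2 : ℕ) : ℝ) + ((d / 2 + 1 : ℕ) : ℝ)) * (C * ℓc * κc * A⁻¹)) +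
            (8 * Real.exp (1 / 4) * b * ℓc * κc + 16 * Real.exp (3 / 8) * (δγ / h ^ 2 * b) +
              256 * Real.exp (1 / 4) * (2 * (δγ / h ^ 2 * b)) *
                (pi2BoundConst d (((2 * R + 2 : ℕ) : ℝ) + ((d / 2 + 1 : ℕ) : ℝ)) * (C * A𝒫b * A⁻¹))))) * A +
        ℓbar * (((8 * Real.exp (1 / 4) * hamNorm (fieldWt h (L : ℝ) d k) ((L : ℝ) ^ k) (L ^ (d * k)) H + C) *
            (ω * A ^ 4)) + C) +
        ℓbar * ((8 * Real.exp (1 / 4) * hamNorm (fieldWt h (L : ℝ) d k) ((L : ℝ) ^ k) (L ^ (d * k)) H + C) *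
            (ω * A ^ 4)) +
        ℓbar * ((8 * Real.exp (1 / 4) * hamNorm (fieldWt h (L : ℝ) d k) ((L : ℝ) ^ k) (L ^ (d * k)) H + C) *
            (ω * A ^ 4)) +
        ((L ^ d : ℕ) : ℝ) * κ₁ ^ (L ^ d) *
        (16 * Real.exp (3 / 8) *
          hamNorm (fieldWt h (L : ℝ) d k) ((L : ℝ) ^ k) (L ^ (d * k)) (nextH D H K - nextH Db H K)) * A) := by
  -- sizes and derived hypotheses
  have hd2 : 2 ≤ d := by omega
  have hp1 : d / 2 + 1 ≤ p := by omega
  have hpR : p ≤ R := by omega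
  have hMord : d / 2 + 1 ≤ Mord := by omega
  have hr₀2 : 2 ≤ r₀ := by omega
  have hL0 : (0 : ℝ) < L := by exact_mod_cast hLodd.pos
  have hA0 : 0 < A := by linarith
  have hDbs' : Db.s = D.s := hDbs.trans hDs.symm
  have hDbL' : Db.L = D.L := hDbL.trans hDL.symm
  have hB₀b : Db.B₀ = blockOf (L ^ k) x₀ := hDbB.trans hB₀
  have hc₀b : Db.c₀ = boxCorner (L ^ k) (starRad R L d k) x₀ := hDbc.trans hc₀
  have h𝔥 : 0 < fieldWt h (L : ℝ) d k := fieldWt_pos hh hL0 d k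
  have hRk : (0 : ℝ) < (L : ℝ) ^ k := by positivity
  have hnn : ∀ G : RelevantHamiltonian ℂ d, 0 ≤ hamNorm (fieldWt h (L : ℝ) d k) ((L : ℝ) ^ k) (L ^ (d * k)) G := fun G => hamNorm_nonneg h𝔥.le hRk.le _ _
  have hb0 : 0 ≤ b := (hnn H).trans hH
  have hH64 : hamNorm (fieldWt h (L : ℝ) d k) ((L : ℝ) ^ k) (L ^ (d * k)) H ≤ 1 / 64 := hH.trans hb
  have hH16 : hamNorm (fieldWt h (L : ℝ) d k) ((L : ℝ) ^ k) (L ^ (d * k)) H ≤ 1 / 16 := hH64.trans (by norm_num)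
  have hH8 : hamNorm (fieldWt h (L : ℝ) d k) ((L : ℝ) ^ k) (L ^ (d * k)) H ≤ 1 / 8 := hH64.trans (by norm_num)
  -- the extracted Hamiltonians
  have hHta : hamNorm (fieldWt h (L : ℝ) d k) ((L : ℝ) ^ k) (L ^ (d * k)) (nextH D H K) ≤ τ :=
    (hamNorm_nextH_abkm_le_of_stepKernelBounds hd2 hLodd hL hM hkN hp1 hpR hr₀2 hB hh hh2a hA1 D hS hB₀ hc₀ H hC hK hKd
      hKloc).trans (by linarith [hH])
  have hHtb : hamNorm (fieldWt h (L : ℝ) d k) ((L : ℝ) ^ k) (L ^ (d * k)) (nextH Db H K) ≤ τ :=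
    (hamNorm_nextH_abkm_le_of_stepKernelBounds hd2 hLodd hL hM hkN hp1 hpR hr₀2 hB hh hh2b hA1 Db hSb hB₀b hc₀b H hC hK hKd
      hKloc).trans (by linarith [hH])
  -- letters
  have hbbω : 8 * Real.exp (1 / 4) * hamNorm (fieldWt h (L : ℝ) d k) ((L : ℝ) ^ k) (L ^ (d * k)) H + 8 * Real.exp (1 / 4) * hamNorm (fieldWt h (L : ℝ) d k) ((L : ℝ) ^ k) (L ^ (d * k)) H ≤ ω := by
    have : 8 * Real.exp (1 / 4) * hamNorm (fieldWt h (L : ℝ) d k) ((L : ℝ) ^ k) (L ^ (d * k)) H ≤ 8 * Real.exp (1 / 4) * b := mul_le_mul_of_nonneg_left hH (by positivity)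
    linarith
  have hκ₁'' : 1 + Real.exp (1 / 4) ≤ κ₁ := by
    have : 0 ≤ 16 * Real.exp (3 / 8) * τ := by
      have := (hnn Ht).trans hHt
      positivity
    linarith
  intro U hU hUc
  have hUne : U.Nonempty := hUc.1
  have hℓnU := hℓn0 U
  -- the six pieces (Σ₁ twin and the defect twin in block form)
  have h0 := tayNormLE_blockPart_kernelOnly_sub_abkm_of_stepKernelBounds (n := n) (lam := lam) (μ := μ) hd hLodd hL hM hkN hp hpM
    hMR hr₀ hB hδ₀ hδ₁ hh hh0 hA1 hκc hκcA hsmallc D Db hDs hDL hS hSb hDbs' hDbL' hDbB hDbc hB₀ hc₀ hℓc hdint hC hK hKt hKd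
    hKloc hU hUc
  have h1 := tayNormLE_remainderOne_kernelOnly_sub_abkm_blockFree_of_stepKernelBounds (p := p) (r₀ := r₀) (A := A) hd hLodd hL hR2
    hM hkN hp1 hpM hMR hr₀ hB hδ₀ hδ₁ hh hh0 hh2a hh2b hA𝒫a hA𝒫b hA1 D Db hDs hDL hS hSb hB₀ hc₀ hDbB hDbc hδγ hγab hℓc hκc
    hdint hU hHt hτ hH hb hC hK hKd hKloc hva hvb hκ₁'
  have h2 := tayNormLE_remainderTwoLarge_kernelOnly_sub_abkm (n := n) (lam := lam) (μ := μ) hd hLodd hL hR2 hM hkN hS hSb hp1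
    hMord hB hδ₀ hδ₁ hh hh0 hA𝒫a hA1 hU hHt hτ hH16 hC hK hKfac hK0 hKd hKloc hℓnU hκp (hdiffU U hU hUc) hω1 hbbω hω3 hωA hκ
  have h3 := tayNormLE_remainderThree_kernelOnly_sub_abkm (n := n) (lam := lam) (μ := μ) hd hLodd hL hR2 hM hkN hS hSb hp1
    hMord hB hδ₀ hδ₁ hh hh0 hA𝒫a hA1 hU hUne hHt hτ hH16 hC hK hKfac hK0 hKd hKloc hℓnU hκp (hdiffU U hU hUc) hω1 hbbω hω3
    hωA hκ
  have h4 := tayNormLE_remainderFour_kernelOnly_sub_abkm (n := n) (lam := lam) (μ := μ) hd hLodd hL hR2 hM hkN hS hSb hp1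
    hMord hB hδ₀ hδ₁ hh hh0 hA𝒫a hA1 hU hHt hτ hH16 hC hK hKfac hK0 hKd hKloc hℓnU hκp (hdiffU U hU hUc) hω1 hbbω hω3 hωA hκ
  have h5' := tayNormLE_blockDefect_sub_abkm_blockFree (n := n) (lam := lam) (μ := μ) (A𝒫 := A𝒫) (p := p) (r₀ := r₀) (A := A) hd hLodd
    hL hR2 hM hkN hp1 hMord hB hδ₀ hδ₁ hh hh0 hA1 D hDs hDL hU (Ht := Ht) (H₁ := nextH D H K) (H₂ := nextH Db H K) hHt hτ
    (hHta.trans hτ) (hHtb.trans hτ) hκ₁''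
  have h5 : TayNormLE ((abkmNormParams L N Mord R p r₀ h θbar A (schedDelta δ₀ δ₁ N) 𝒞).gauge (k + 1) U) r₀
      ((abkmWeightData L N Mord R θbar (schedDelta δ₀ δ₁ N) 𝒞).weight (k + 1) U)
      (fun φ => (∑ B ∈ blockPartIndex D U,
        bprod (L ^ k) (fun B' => expNegH Ht B' φ) (U \ B) *
            bprod (L ^ k) (fun B' => expNegH (-Ht) B' φ) (B \ U) *
          (expNegH (nextH D H K) B φ - expNegH Ht B φ)) -
        (∑ B ∈ blockPartIndex D U,
        bprod (L ^ k) (fun B' => expNegH Ht B' φ) (U \ B) *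
            bprod (L ^ k) (fun B' => expNegH (-Ht) B' φ) (B \ U) *
          (expNegH (nextH Db H K) B φ - expNegH Ht B φ))) (((L ^ d : ℕ) : ℝ) * κ₁ ^ (L ^ d) *
        (16 * Real.exp (3 / 8) *
          hamNorm (fieldWt h (L : ℝ) d k) ((L : ℝ) ^ k) (L ^ (d * k)) (nextH D H K - nextH Db H K)) *
        (A * (abkmNormParams L N Mord R p r₀ h θbar A (schedDelta δ₀ δ₁ N) 𝒞).aFactor (k + 1) U)) := by
    have e : (fun φ => (∑ B ∈ blockPartIndex D U,
        bprod (L ^ k) (fun B' => expNegH Ht B' φ) (U \ B) *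
            bprod (L ^ k) (fun B' => expNegH (-Ht) B' φ) (B \ U) *
          (expNegH (nextH D H K) B φ - expNegH Ht B φ)) -
        (∑ B ∈ blockPartIndex D U,
        bprod (L ^ k) (fun B' => expNegH Ht B' φ) (U \ B) *
            bprod (L ^ k) (fun B' => expNegH (-Ht) B' φ) (B \ U) *
          (expNegH (nextH Db H K) B φ - expNegH Ht B φ))) = (fun φ => ∑ B ∈ blockPartIndex D U,
        bprod (L ^ k) (fun B' => expNegH Ht B' φ) (U \ B) *
            bprod (L ^ k) (fun B' => expNegH (-Ht) B' φ) (B \ U) *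
          (expNegH (nextH D H K) B φ - expNegH (nextH Db H K) B φ)) := by
      funext φ
      rw [← sum_sub_distrib]
      exact sum_congr rfl fun B _ => by ring
    rw [e]
    exact h5'
  have hglue := tayNormLE_nextK_freeHt_kernel_sub_of_pieces (n := n) (lam := lam) (μ := μ) hd2 hLodd hL hM hkN hp1 hpR hMord hB hδ₀
    hδ₁ hh hh0 hA0 D Db hDs hDL hDbs hDbL hS hSb hB₀ hc₀ hB₀b hc₀b hH8 Ht hC hK hKfac hK0 hKd hKloc hUne h0 h1 h2 h3 h4 h5
  refine hglue.mono ?_ fun φ => ((abkmWeightData L N Mord R θbar (schedDelta δ₀ δ₁ N) 𝒞).weight_pos (k + 1) U φ).le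
  -- block counts: `|U|_k = L^d |U|_{k+1}`, `|U|_{k+1} ≥ 1`, `aFactor = (A^u)⁻¹`
  have hsodd : Odd (L ^ k) := hLodd.pow
  have hMeq : M = L * L ^ k * L ^ (N - k - 1) := by
    rw [hM, ← pow_succ', ← pow_add]; congr 1; omega
  have hUm : IsPolymer (L * L ^ k) U := by rw [← pow_succ']; exact hU
  have hm0 : (blocks (L ^ k) U).card = L ^ d * (blocks (L * L ^ k) U).card :=
    TorusPolymer.card_blocks_eq_mul hMeq hsodd hLodd hLodd.pow hUm
  have hm1 : 1 ≤ (blocks (L * L ^ k) U).card := by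
    obtain ⟨u, hu⟩ := hUc.1
    exact card_pos.2 ⟨blockOf (L * L ^ k) u, mem_blocks.2 ⟨u, hu, rfl⟩⟩
  have haF : (abkmNormParams L N Mord R p r₀ h θbar A (schedDelta δ₀ δ₁ N) 𝒞).aFactor (k + 1) U =
      (A ^ (blocks (L * L ^ k) U).card)⁻¹ := by
    show (A ^ numBlocks (L ^ (k + 1)) U)⁻¹ = _
    rw [← card_blocks_eq_numBlocks, pow_succ']
  rw [haF]
  -- nonnegativity of the letters
  have hnH := hnn H
  have hω0 : 0 ≤ ω := le_trans (by positivity) hω3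
  have hκ0 : 0 ≤ κ := by linarith [hκ, Real.exp_pos (1 / 4)]
  have hE2b0 : 0 ≤ ((8 * Real.exp (1 / 4) * hamNorm (fieldWt h (L : ℝ) d k) ((L : ℝ) ^ k) (L ^ (d * k)) H + C) *
            (ω * A ^ 4)) := by positivity
  have hX3b0 : 0 ≤ κ ^ (L ^ d) * ((2 * (2 * κ * max 1 (max A𝒫a κp))) ^ ((2 ^ (d + 1) + 2) ^ d * L ^ d) * (4 : ℝ) ^ ((2 ^ (d + 1) + 2) ^ d * L ^ d)) := by positivity
  have hX2b0 : 0 ≤ κ ^ (L ^ d) * ((2 * κ * max 1 (max A𝒫a κp)) ^ ((2 ^ (d + 1) + 2) ^ d * L ^ d) * (2 : ℝ) ^ ((2 ^ (d + 1) + 2) ^ d * L ^ d)) := by positivity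
  have hApow : 0 ≤ A ^ ((1 + 1 / ((2 * (2 ^ d + 1) + 6 : ℝ) ^ d)) - 1 : ℝ) := Real.rpow_nonneg hA0.le _
  have hAu0 : 0 ≤ (A ^ (blocks (L * L ^ k) U).card)⁻¹ := by positivity
  -- the gains (with room)
  have g3b : κ ^ (blocks (L ^ k) U).card * (((2 * (2 * κ * max 1 (max A𝒫a κp))) ^ ((2 ^ (d + 1) + 2) ^ d * L ^ d) * (4 : ℝ) ^ ((2 ^ (d + 1) + 2) ^ d * L ^ d)) ^ (blocks (L * L ^ k) U).card * A ^ (-((1 + 1 / ((2 * (2 ^ d + 1) + 6 : ℝ) ^ d)) * (blocks (L * L ^ k) U).card) : ℝ)) ≤ lamR ^ (blocks (L * L ^ k) U).card * (A ^ (blocks (L * L ^ k) U).card)⁻¹ := by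
    rw [hm0, pow_mul, ← mul_assoc, ← mul_pow]
    exact pow_mul_rpow_le_geom_inv_pow (N0 := 1) hA1 hX3b0 hApow hlam0 hlam1 le_rfl (by rw [pow_one]; exact hc3b) le_rfl hm1
  have g2b : κ ^ (blocks (L ^ k) U).card * (((2 * κ * max 1 (max A𝒫a κp)) ^ ((2 ^ (d + 1) + 2) ^ d * L ^ d) * (2 : ℝ) ^ ((2 ^ (d + 1) + 2) ^ d * L ^ d)) ^ (blocks (L * L ^ k) U).card * A ^ (-((1 + 1 / ((2 * (2 ^ d + 1) + 6 : ℝ) ^ d)) * (blocks (L * L ^ k) U).card) : ℝ)) ≤ lamR ^ (blocks (L * L ^ k) U).card * (A ^ (blocks (L * L ^ k) U).card)⁻¹ := by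
    rw [hm0, pow_mul, ← mul_assoc, ← mul_pow]
    exact pow_mul_rpow_le_geom_inv_pow (N0 := 1) hA1 hX2b0 hApow hlam0 hlam1 le_rfl (by rw [pow_one]; exact hc2b) le_rfl hm1
  have hℓlam : ℓnf U * lamR ^ (blocks (L * L ^ k) U).card ≤ ℓbar := hℓn U
  have hlamu0 : 0 ≤ lamR ^ (blocks (L * L ^ k) U).card := pow_nonneg hlam0 _
  -- termwise bounds
  have e3b : ∀ (E : ℝ), 0 ≤ E → ℓnf U * (κ ^ (blocks (L ^ k) U).card * E * (((2 * (2 * κ * max 1 (max A𝒫a κp))) ^ ((2 ^ (d + 1) + 2) ^ d * L ^ d) * (4 : ℝ) ^ ((2 ^ (d + 1) + 2) ^ d * L ^ d)) ^ (blocks (L * L ^ k) U).card * A ^ (-((1 + 1 / ((2 * (2 ^ d + 1) + 6 : ℝ) ^ d)) * (blocks (L * L ^ k) U).card) : ℝ))) ≤ ℓbar * E * (A ^ (blocks (L * L ^ k) U).card)⁻¹ := by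
    intro E hE
    have h1 : κ ^ (blocks (L ^ k) U).card * E * (((2 * (2 * κ * max 1 (max A𝒫a κp))) ^ ((2 ^ (d + 1) + 2) ^ d * L ^ d) * (4 : ℝ) ^ ((2 ^ (d + 1) + 2) ^ d * L ^ d)) ^ (blocks (L * L ^ k) U).card * A ^ (-((1 + 1 / ((2 * (2 ^ d + 1) + 6 : ℝ) ^ d)) * (blocks (L * L ^ k) U).card) : ℝ)) ≤ E * (lamR ^ (blocks (L * L ^ k) U).card * (A ^ (blocks (L * L ^ k) U).card)⁻¹) := by
      calc κ ^ (blocks (L ^ k) U).card * E * (((2 * (2 * κ * max 1 (max A𝒫a κp))) ^ ((2 ^ (d + 1) + 2) ^ d * L ^ d) * (4 : ℝ) ^ ((2 ^ (d + 1) + 2) ^ d * L ^ d)) ^ (blocks (L * L ^ k) U).card * A ^ (-((1 + 1 / ((2 * (2 ^ d + 1) + 6 : ℝ) ^ d)) * (blocks (L * L ^ k) U).card) : ℝ)) = E * (κ ^ (blocks (L ^ k) U).card * (((2 * (2 * κ * max 1 (max A𝒫a κp))) ^ ((2 ^ (d + 1) + 2) ^ d * L ^ d) * (4 : ℝ) ^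 ((2 ^ (d + 1) + 2) ^ d * L ^ d)) ^ (blocks (L * L ^ k) U).card * A ^ (-((1 + 1 / ((2 * (2 ^ d + 1) + 6 : ℝ) ^ d)) * (blocks (L * L ^ k) U).card) : ℝ))) := by ring
        _ ≤ E * (lamR ^ (blocks (L * L ^ k) U).card * (A ^ (blocks (L * L ^ k) U).card)⁻¹) := mul_le_mul_of_nonneg_left g3b hE
    have h2 := mul_le_mul_of_nonneg_left h1 hℓnU
    have h3 : ℓnf U * (E * (lamR ^ (blocks (L * L ^ k) U).card * (A ^ (blocks (L * L ^ k) U).card)⁻¹)) = (ℓnf U * lamR ^ (blocks (L * L ^ k) U).card) * (E * (A ^ (blocks (L * L ^ k) U).card)⁻¹) := by ring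
    have h4 : (ℓnf U * lamR ^ (blocks (L * L ^ k) U).card) * (E * (A ^ (blocks (L * L ^ k) U).card)⁻¹) ≤ ℓbar * (E * (A ^ (blocks (L * L ^ k) U).card)⁻¹) :=
      mul_le_mul_of_nonneg_right hℓlam (mul_nonneg hE hAu0)
    calc _ ≤ ℓnf U * (E * (lamR ^ (blocks (L * L ^ k) U).card * (A ^ (blocks (L * L ^ k) U).card)⁻¹)) := h2
      _ = (ℓnf U * lamR ^ (blocks (L * L ^ k) U).card) * (E * (A ^ (blocks (L * L ^ k) U).card)⁻¹) := h3
      _ ≤ ℓbar * (E * (A ^ (blocks (L * L ^ k) U).card)⁻¹) := h4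
      _ = ℓbar * E * (A ^ (blocks (L * L ^ k) U).card)⁻¹ := by ring
  have e2bb : ℓnf U * (κ ^ (blocks (L ^ k) U).card * ((8 * Real.exp (1 / 4) * hamNorm (fieldWt h (L : ℝ) d k) ((L : ℝ) ^ k) (L ^ (d * k)) H + C) *
            (ω * A ^ 4)) * (((2 * (2 * κ * max 1 (max A𝒫a κp))) ^ ((2 ^ (d + 1) + 2) ^ d * L ^ d) * (4 : ℝ) ^ ((2 ^ (d + 1) + 2) ^ d * L ^ d)) ^ (blocks (L * L ^ k) U).card * A ^ (-((1 + 1 / ((2 * (2 ^ d + 1) + 6 : ℝ) ^ d)) * (blocks (L * L ^ k) U).card) : ℝ)) + κ ^ (blocks (L ^ k) U).card * C * (((2 * κ * max 1 (max A𝒫a κp)) ^ ((2 ^ (d + 1) + 2) ^ d * L ^ d) * (2 : ℝ) ^ ((2 ^ (d + 1) + 2) ^ d * L ^ d)) ^ (blocks (L * L ^ k) U).card * A ^ (-((1 + 1 / ((2 * (2 ^ d + 1) + 6 : ℝ) ^ d)) * (blocks (L * L ^ k) U).card) : ℝ))) ≤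
      ℓbar * (((8 * Real.exp (1 / 4) * hamNorm (fieldWt h (L : ℝ) d k) ((L : ℝ) ^ k) (L ^ (d * k)) H + C) *
            (ω * A ^ 4)) + C) * (A ^ (blocks (L * L ^ k) U).card)⁻¹ := by
    have h1 : κ ^ (blocks (L ^ k) U).card * ((8 * Real.exp (1 / 4) * hamNorm (fieldWt h (L : ℝ) d k) ((L : ℝ) ^ k) (L ^ (d * k)) H + C) *
            (ω * A ^ 4)) * (((2 * (2 * κ * max 1 (max A𝒫a κp))) ^ ((2 ^ (d + 1) + 2) ^ d * L ^ d) * (4 : ℝ) ^ ((2 ^ (d + 1) + 2) ^ d * L ^ d)) ^ (blocks (L * L ^ k) U).card * A ^ (-((1 + 1 / ((2 * (2 ^ d + 1) + 6 : ℝ) ^ d)) * (blocks (L * L ^ k) U).card) : ℝ)) ≤ ((8 * Real.exp (1 / 4) * hamNorm (fieldWt h (L : ℝ) d k) ((L : ℝ) ^ k) (L ^ (d * k)) H + C) *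
            (ω * A ^ 4)) * (lamR ^ (blocks (L * L ^ k) U).card * (A ^ (blocks (L * L ^ k) U).card)⁻¹) := by
      calc κ ^ (blocks (L ^ k) U).card * ((8 * Real.exp (1 / 4) * hamNorm (fieldWt h (L : ℝ) d k) ((L : ℝ) ^ k) (L ^ (d * k)) H + C) *
            (ω * A ^ 4)) * (((2 * (2 * κ * max 1 (max A𝒫a κp))) ^ ((2 ^ (d + 1) + 2) ^ d * L ^ d) * (4 : ℝ) ^ ((2 ^ (d + 1) + 2) ^ d * L ^ d)) ^ (blocks (L * L ^ k) U).card * A ^ (-((1 + 1 / ((2 * (2 ^ d + 1) + 6 : ℝ) ^ d)) * (blocks (L * L ^ k) U).card) : ℝ)) = ((8 * Real.exp (1 / 4) * hamNorm (fieldWt h (L : ℝ) d k) ((L : ℝ) ^ k) (L ^ (d * k)) H + C) *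
            (ω * A ^ 4)) * (κ ^ (blocks (L ^ k) U).card * (((2 * (2 * κ * max 1 (max A𝒫a κp))) ^ ((2 ^ (d + 1) + 2) ^ d * L ^ d) * (4 : ℝ) ^ ((2 ^ (d + 1) + 2) ^ d * L ^ d)) ^ (blocks (L * L ^ k) U).card * A ^ (-((1 + 1 / ((2 * (2 ^ d + 1) + 6 : ℝ) ^ d)) * (blocks (L * L ^ k) U).card) : ℝ))) := by ring
        _ ≤ ((8 * Real.exp (1 / 4) * hamNorm (fieldWt h (L : ℝ) d k) ((L : ℝ) ^ k) (L ^ (d * k)) H + C) *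
            (ω * A ^ 4)) * (lamR ^ (blocks (L * L ^ k) U).card * (A ^ (blocks (L * L ^ k) U).card)⁻¹) := mul_le_mul_of_nonneg_left g3b hE2b0
    have h1' : κ ^ (blocks (L ^ k) U).card * C * (((2 * κ * max 1 (max A𝒫a κp)) ^ ((2 ^ (d + 1) + 2) ^ d * L ^ d) * (2 : ℝ) ^ ((2 ^ (d + 1) + 2) ^ d * L ^ d)) ^ (blocks (L * L ^ k) U).card * A ^ (-((1 + 1 / ((2 * (2 ^ d + 1) + 6 : ℝ) ^ d)) * (blocks (L * L ^ k) U).card) : ℝ)) ≤ C * (lamR ^ (blocks (L * L ^ k) U).card * (A ^ (blocks (L * L ^ k) U).card)⁻¹) := by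
      calc κ ^ (blocks (L ^ k) U).card * C * (((2 * κ * max 1 (max A𝒫a κp)) ^ ((2 ^ (d + 1) + 2) ^ d * L ^ d) * (2 : ℝ) ^ ((2 ^ (d + 1) + 2) ^ d * L ^ d)) ^ (blocks (L * L ^ k) U).card * A ^ (-((1 + 1 / ((2 * (2 ^ d + 1) + 6 : ℝ) ^ d)) * (blocks (L * L ^ k) U).card) : ℝ)) = C * (κ ^ (blocks (L ^ k) U).card * (((2 * κ * max 1 (max A𝒫a κp)) ^ ((2 ^ (d + 1) + 2) ^ d * L ^ d) * (2 : ℝ) ^ ((2 ^ (d + 1) + 2) ^ d * L ^ d)) ^ (blocks (L * L ^ k) U).card * A ^ (-((1 + 1 / ((2 * (2 ^ d + 1) + 6 : ℝ) ^ d)) * (blocks (L * L ^ k) U).card) : ℝ))) := by ring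
        _ ≤ C * (lamR ^ (blocks (L * L ^ k) U).card * (A ^ (blocks (L * L ^ k) U).card)⁻¹) := mul_le_mul_of_nonneg_left g2b hC
    have h2 := mul_le_mul_of_nonneg_left (add_le_add h1 h1') hℓnU
    have h3 : ℓnf U * (((8 * Real.exp (1 / 4) * hamNorm (fieldWt h (L : ℝ) d k) ((L : ℝ) ^ k) (L ^ (d * k)) H + C) *
            (ω * A ^ 4)) * (lamR ^ (blocks (L * L ^ k) U).card * (A ^ (blocks (L * L ^ k) U).card)⁻¹) + C * (lamR ^ (blocks (L * L ^ k) U).card * (A ^ (blocks (L * L ^ k) U).card)⁻¹)) =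
        (ℓnf U * lamR ^ (blocks (L * L ^ k) U).card) * ((((8 * Real.exp (1 / 4) * hamNorm (fieldWt h (L : ℝ) d k) ((L : ℝ) ^ k) (L ^ (d * k)) H + C) *
            (ω * A ^ 4)) + C) * (A ^ (blocks (L * L ^ k) U).card)⁻¹) := by ring
    have h4 : (ℓnf U * lamR ^ (blocks (L * L ^ k) U).card) * ((((8 * Real.exp (1 / 4) * hamNorm (fieldWt h (L : ℝ) d k) ((L : ℝ) ^ k) (L ^ (d * k)) H + C) *
            (ω * A ^ 4)) + C) * (A ^ (blocks (L * L ^ k) U).card)⁻¹) ≤ ℓbar * ((((8 * Real.exp (1 / 4) * hamNorm (fieldWt h (L : ℝ) d k) ((L : ℝ) ^ k) (L ^ (d * k)) H + C) *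
            (ω * A ^ 4)) + C) * (A ^ (blocks (L * L ^ k) U).card)⁻¹) :=
      mul_le_mul_of_nonneg_right hℓlam (mul_nonneg (add_nonneg hE2b0 hC) hAu0)
    calc _ ≤ _ := h2
      _ = _ := h3
      _ ≤ _ := h4
      _ = ℓbar * (((8 * Real.exp (1 / 4) * hamNorm (fieldWt h (L : ℝ) d k) ((L : ℝ) ^ k) (L ^ (d * k)) H + C) *
            (ω * A ^ 4)) + C) * (A ^ (blocks (L * L ^ k) U).card)⁻¹ := by ring
  have t0 : (C * ((L : ℝ) ^ d * ((ℓc * κc) * abkmContrConst d L R) +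
          ℓc * largePartEps d L A κc (1 + 1 / ((2 * (2 ^ d + 1) + 6 : ℝ) ^ d)) +
          ℓc * largePartEps d L A κc (1 + 1 / ((2 * (2 ^ d + 1) + 6 : ℝ) ^ d)))) * (A ^ (blocks (L * L ^ k) U).card)⁻¹ ≤ (C * ((L : ℝ) ^ d * ((ℓc * κc) * abkmContrConst d L R) +
          ℓc * largePartEps d L A κc (1 + 1 / ((2 * (2 ^ d + 1) + 6 : ℝ) ^ d)) +
          ℓc * largePartEps d L A κc (1 + 1 / ((2 * (2 ^ d + 1) + 6 : ℝ) ^ d)))) * (A ^ (blocks (L * L ^ k) U).card)⁻¹ := le_rfl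
  have t1b : ((L ^ d : ℕ) : ℝ) * κ₁ ^ (L ^ d) *
        (16 * Real.exp (3 / 8) * τ *
            ((1 + 8 * pi2BoundConst d (((2 * R + 2 : ℕ) : ℝ) + ((d / 2 + 1 : ℕ) : ℝ))) * (C * ℓc * κc * A⁻¹)) +
          (512 * Real.exp (1 / 4) *
              (b * (pi2BoundConst d (((2 * R + 2 : ℕ) : ℝ) + ((d / 2 + 1 : ℕ) : ℝ)) * (C * ℓc * κc * A⁻¹))) +
            256 * Real.exp (1 / 4) *
              (pi2BoundConst d (((2 * R + 2 : ℕ) : ℝ) + ((d / 2 + 1 : ℕ) : ℝ)) * (C * A𝒫b * A⁻¹) +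
                pi2BoundConst d (((2 * R + 2 : ℕ) : ℝ) + ((d / 2 + 1 : ℕ) : ℝ)) * (C * ℓc * κc * A⁻¹)) *
              (pi2BoundConst d (((2 * R + 2 : ℕ) : ℝ) + ((d / 2 + 1 : ℕ) : ℝ)) * (C * ℓc * κc * A⁻¹)) +
            (8 * Real.exp (1 / 4) * b * ℓc * κc + 16 * Real.exp (3 / 8) * (δγ / h ^ 2 * b) +
              256 * Real.exp (1 / 4) * (2 * (δγ / h ^ 2 * b)) *
                (pi2BoundConst d (((2 * R + 2 : ℕ) : ℝ) + ((d / 2 + 1 : ℕ) : ℝ)) * (C * A𝒫b * A⁻¹))))) *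
        (A * (A ^ (blocks (L * L ^ k) U).card)⁻¹) ≤ ((L ^ d : ℕ) : ℝ) * κ₁ ^ (L ^ d) *
        (16 * Real.exp (3 / 8) * τ *
            ((1 + 8 * pi2BoundConst d (((2 * R + 2 : ℕ) : ℝ) + ((d / 2 + 1 : ℕ) : ℝ))) * (C * ℓc * κc * A⁻¹)) +
          (512 * Real.exp (1 / 4) *
              (b * (pi2BoundConst d (((2 * R + 2 : ℕ) : ℝ) + ((d / 2 + 1 : ℕ) : ℝ)) * (C * ℓc * κc * A⁻¹))) +
            256 * Real.exp (1 / 4) *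
              (pi2BoundConst d (((2 * R + 2 : ℕ) : ℝ) + ((d / 2 + 1 : ℕ) : ℝ)) * (C * A𝒫b * A⁻¹) +
                pi2BoundConst d (((2 * R + 2 : ℕ) : ℝ) + ((d / 2 + 1 : ℕ) : ℝ)) * (C * ℓc * κc * A⁻¹)) *
              (pi2BoundConst d (((2 * R + 2 : ℕ) : ℝ) + ((d / 2 + 1 : ℕ) : ℝ)) * (C * ℓc * κc * A⁻¹)) +
            (8 * Real.exp (1 / 4) * b * ℓc * κc + 16 * Real.exp (3 / 8) * (δγ / h ^ 2 * b) +
              256 * Real.exp (1 / 4) * (2 * (δγ / h ^ 2 * b)) *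
                (pi2BoundConst d (((2 * R + 2 : ℕ) : ℝ) + ((d / 2 + 1 : ℕ) : ℝ)) * (C * A𝒫b * A⁻¹))))) * A * (A ^ (blocks (L * L ^ k) U).card)⁻¹ := le_of_eq (by ring)
  have t5 : ((L ^ d : ℕ) : ℝ) * κ₁ ^ (L ^ d) *
        (16 * Real.exp (3 / 8) *
          hamNorm (fieldWt h (L : ℝ) d k) ((L : ℝ) ^ k) (L ^ (d * k)) (nextH D H K - nextH Db H K)) *
        (A * (A ^ (blocks (L * L ^ k) U).card)⁻¹) ≤ ((L ^ d : ℕ) : ℝ) * κ₁ ^ (L ^ d) *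
        (16 * Real.exp (3 / 8) *
          hamNorm (fieldWt h (L : ℝ) d k) ((L : ℝ) ^ k) (L ^ (d * k)) (nextH D H K - nextH Db H K)) * A * (A ^ (blocks (L * L ^ k) U).card)⁻¹ := le_of_eq (by ring)
  have t3b := e3b _ hE2b0
  have t4b := e3b _ hE2b0
  refine (add_le_add (add_le_add (add_le_add (add_le_add (add_le_add t0 t1b) e2bb) t3b) t4b) t5).trans (le_of_eq ?_)
  ring

end Literature.MathematicalPhysics.StatisticalMechanics.GradientRG

end
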